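import Summits.QuantumFields.BalabanUV.Beta.GAN24.E3UnitSplitLevels
import Summits.QuantumFields.BalabanUV.Beta.SpineRootedSc

/-!
# `BalabanUV.Beta.GAN24.E3UnitSplitLevelsAt` — binder row G-an2-4 / (CONV-C), CT-ROUTE ∕ road S3 AT THE IN-BLOCK ROOT: package (ρ-b) of the row owner gan24-p1-g21's
# WANTED «ROOTED-S3-Λ» ([GAN24P1-G21-ONLINE] (W5), INBOX [GAN24P1-G21-INBOX1]) — **THE Λ STATEMENTS OF `E3UnitSplitLevels` THAT NAME `lagrInc` ∕ `hessFF`, RE-RUN WITH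
# THE ROOTED INCREMENT `SpineRooted.lagrIncAt d ρ Lc` ∕ an1's ROOTED TABLE `hessFFAt ρ Lc`** (the block lemmas and the three Λ unit-split templates), for EVERY root `ρ`
# (the templates are exponent algebra over the root-free `e3FF_unit_split_of`; no box hypothesis is needed at this level — it enters in (ρ-a)∕(ρ-c)∕(ρ-d) through
# an1's support ∕ `biLoc` lemmas), plus the `ρ = 0` bridges to the base templates (`lagrIncAt_zero` ∕ `hessFFAt_zero`)

NOT IN PRINT; OUR BOOKKEEPING (G-an2-4 formalisation swarm → CRUX TEAM (2), leaf prover `b2b-balaban-gan24-formalise-leaf-01`, gen 60 — the lineage that typed the base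
module (g10); «MINE (ρ-b)» journal `CLAIMS.log` l.34234; METHOD = the owner's gen-6 `mkroot.py` rule: base text, namespace `…At`, same theorem names, `lagrInc d Lc ↦
lagrIncAt d ρ Lc`, `hessFF Lc ↦ hessFFAt ρ Lc`, an1's rooted block lemmas `hessFFAt_inl_inr ∕ hessFFAt_inr`, every root-free base lemma (`SLam_block_zero`,
`avgLift_block_zero`, `e3FF_unit_split_of`, `e3Lam_residual`) BY NAME from `E3UnitSplit(Levels)`, base modules untouched).  [folklore]; 0 `def`, 0 cited facts,
0 `def … : Prop`, 0 sorry; NO estimate.  HONEST FRAMING (cell contract, verbatim): «discharging `BetaPertH` makes Bałaban's UV stability UNCONDITIONAL — a real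
constructive-QFT result; it is NOT the continuum limit and NOT the Clay problem.»  HONEST DEPENDENCY (verbatim): «continuum YM on T⁴ ⇐ BetaPertH ∧ nine spine estimates
(0/9 proved); BetaPertH ⇐ (D1) ∧ (D4) ∧ CAP+tail; G-an2-4 gates asym, D1 and NE2/3/4.»

## What (generic `d`, every root `ρ : Fin (d+1) → ℤ`; level `ℓ`, `M = Lc^ℓ`, member `p = ℓ+k+1`, `N = Lc^p`)
* §4-ρ blocks: **`lagrIncAt_inl_inr`**, **`lagrIncAt_inr`** (the rooted Lagrange increment is ff-supported: an1's `hessFFAt_inl_inr ∕ hessFFAt_inr`), **`SLam0At_inl_inr`**,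
  **`SLam0At_inr`** (`S₀`'s rooted Lagrange stencil `SLam Lc (lamCoeffOf (KInv Lc) Lc) (hessFFAt ρ Lc)`).
* §5-ρ Λ templates: **`e3Lam_unit_split`** (`F = lagrIncAt d ρ Lc (Lc^ℓ) (Lc^{ℓ+1})`), **`e3LamTop_unit_split`** (`k = 0`), **`e3Lam0_unit_split`** (`ℓ = 0`, the rooted `S₀` stencil) —
  `N^{2(d+1)}·e3OfS N ((Lc^{d+1})^k·cΛ·M^{2d+4} • F) = −(cΛ∕Lc^{d+1})·N^{d−2}·M^{d+3}·[unit sandwich of F]`, VERBATIM the base shapes with the rooted `F`.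
* bridges: `e3Lam_unit_split_zero_root` ∕ `e3Lam0_unit_split_zero_root` — at `ρ = 0` the rooted templates ARE the base ones (`lagrIncAt_zero` ∕ `hessFFAt_zero`).
USE: (ρ-c) `TaylorRowLamAt` ∕ (ρ-d) `TaylorRowLamTopAt`, `S3ShapeL0At` consume these in place of the base templates; the owner's `BornLambdaUndressedRow` reads the rooted rows.
Discharges NOTHING of (hS, hSall) ∕ «E3Shape»; NEVER «G-an2-4 closed»; NOT D1, NOT BetaPertH, NOT continuum, NOT Clay.
-/

noncomputable section

open Finset
open scoped BigOperators
open Literature.MathematicalPhysics.QuantumFieldTheory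
open Literature.MathematicalPhysics.QuantumFieldTheory.Balaban1983to89
open Literature.MathematicalPhysics.QuantumFieldTheory.Balaban1983to89.Beta
open ExpKernelCalculus (MKer comp)
open KernelSpecInstance (wH wΦ)
open KKTFluctuationKernel (Gam GamΦ)
open OneStepResolventKernel (Fib LocStencil KInv wsum vertexOf KInv_inl_inr_coarse KInv_inr_inl_coarse KInv_inl_inl)
open StepJetData (wilsonA mfNeg)
open AveragingHessianKernels (vhS hessFF)
open AveragingHessianKernelsRooted (hessFFAt hessFFAt_inl_inr hessFFAt_inr hessFFAt_zero)
open InterLevelTransport (SLam avgLift cwsum cwsum_apply)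
open BalabanStepJets (S0 lamCoeffOf)
open BalabanCompositeJets (Sc pushSum pushSum_inl_inl borderInc lagrInc)
open BalabanStepJetsSucc (e3Of mmRead)
open Summit.QuantumFields.BalabanUV.Beta.SpineRooted (lagrIncAt lagrIncAt_zero)
open Summit.QuantumFields.BalabanUV.Beta.GAN24.E3UnitSplit (e3OfS SLam_block_zero avgLift_block_zero e3FF_unit_split_of)

namespace Summit.QuantumFields.BalabanUV.Beta.GAN24.E3UnitSplitLevelsAt

variable {d : ℕ}

/-! ## §4-ρ Block supports of the rooted Λ increments -/

section Blocks

/-- [folklore] **THE ROOTED LAGRANGE INCREMENT IS FIELD–FIELD-SUPPORTED** (an1's rooted constraint Hessian `hessFFAt ρ` is): no (inl, inr) block. -/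
theorem lagrIncAt_inl_inr (ρ : Fin (d + 1) → ℤ) {Lc M N' : ℕ} [NeZero N'] (κ : Fin (d + 1)) (u x z : Fin (d + 1) → ℤ) (α ν : Fin (d + 1)) :
    lagrIncAt d ρ Lc M N' κ u x z (Sum.inl α) (Sum.inr ν) = 0 :=
  SLam_block_zero _ _ _ _ (fun μ y x z => avgLift_block_zero _ _ _ (fun x z => hessFFAt_inl_inr ρ Lc μ y x z α ν) x z) κ u x z

/-- [folklore] The rooted Lagrange increment has no multiplier rows. -/
theorem lagrIncAt_inr (ρ : Fin (d + 1) → ℤ) {Lc M N' : ℕ} [NeZero N'] (κ : Fin (d + 1)) (u x z : Fin (d + 1) → ℤ) (μ : Fin (d + 1)) (b : Fib d) :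
    lagrIncAt d ρ Lc M N' κ u x z (Sum.inr μ) b = 0 :=
  SLam_block_zero _ _ _ _ (fun μ' y x z => avgLift_block_zero _ _ _ (fun x z => hessFFAt_inr ρ Lc μ' y x z μ b) x z) κ u x z

/-- [folklore] `S₀`'s ROOTED Lagrange stencil has no (inl, inr) block. -/
theorem SLam0At_inl_inr (ρ : Fin (d + 1) → ℤ) {Lc : ℕ} [NeZero Lc] (κ : Fin (d + 1)) (u x z : Fin (d + 1) → ℤ) (α ν : Fin (d + 1)) :
    SLam Lc (lamCoeffOf (KInv (N := Lc) (d := d)) Lc) (fun μ y => hessFFAt ρ Lc μ y) κ u x z (Sum.inl α) (Sum.inr ν) = 0 :=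
  SLam_block_zero _ _ _ _ (fun μ y x z => hessFFAt_inl_inr ρ Lc μ y x z α ν) κ u x z

/-- [folklore] `S₀`'s ROOTED Lagrange stencil has no multiplier rows. -/
theorem SLam0At_inr (ρ : Fin (d + 1) → ℤ) {Lc : ℕ} [NeZero Lc] (κ : Fin (d + 1)) (u x z : Fin (d + 1) → ℤ) (μ : Fin (d + 1)) (b : Fib d) :
    SLam Lc (lamCoeffOf (KInv (N := Lc) (d := d)) Lc) (fun μ y => hessFFAt ρ Lc μ y) κ u x z (Sum.inr μ) b = 0 :=
  SLam_block_zero _ _ _ _ (fun μ' y x z => hessFFAt_inr ρ Lc μ' y x z μ b) κ u x z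

end Blocks

/-! ## §5-ρ The Λ templates per level with the rooted increment (residual power displayed, as in the base module) -/

section Levels

variable {Lc : ℕ} [NeZero Lc]

/-- [folklore] **THE (Λ) TEMPLATE, LEVEL `ℓ ≥ 1`, ROOTED** (every root `ρ`): `F = lagrIncAt d ρ Lc (Lc^ℓ) (Lc^{ℓ+1})` in the root-free `e3FF_unit_split_of`. -/
theorem e3Lam_unit_split (ρ : Fin (d + 1) → ℤ) (cΛ : ℝ) (ℓ k p : ℕ) (hp : p = ℓ + k + 1) (κ' : Fin (d + 1)) (u' x' z' : Fin (d + 1) → ℤ) (α β : Fin (d + 1)) :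
    ((Lc : ℝ) ^ p) ^ (2 * (d + 1)) *
        e3OfS (Lc ^ p) (fun κ u => (((Lc : ℝ) ^ (d + 1)) ^ k * (cΛ * ((Lc : ℝ) ^ ℓ) ^ (2 * d + 4))) • lagrIncAt d ρ Lc (Lc ^ ℓ) (Lc ^ (ℓ + 1)) κ u)
          κ' u' x' z' (Sum.inl α) (Sum.inl β) =
      -(cΛ / (Lc : ℝ) ^ (d + 1)) * ((Lc : ℝ) ^ p) ^ ((d : ℤ) - 2) * ((Lc : ℝ) ^ ℓ) ^ (d + 3) *
        ∑' y : Fin (d + 1) → ℤ, ∑ l' : Fin (d + 1),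
          (∑' w : Fin (d + 1) → ℤ, ∑ l : Fin (d + 1), (((Lc : ℝ) ^ p) ^ (d + 2) * GamΦ (N := Lc ^ p) α x' l w) *
              ∑ κ'' : Fin (d + 1), (((Lc : ℝ) ^ p) ^ (d + 1))⁻¹ * ∑' u : Fin (d + 1) → ℤ,
                (((Lc : ℝ) ^ p) ^ (d + 2) * wH (N := Lc ^ p) κ'' κ' (u - ((Lc ^ p : ℕ) : ℤ) • u')) *
                  lagrIncAt d ρ Lc (Lc ^ ℓ) (Lc ^ (ℓ + 1)) κ'' u w y (Sum.inl l) (Sum.inl l')) *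
            (((Lc : ℝ) ^ p) ^ (d + 2) * wH (N := Lc ^ p) l' β (y - ((Lc ^ p : ℕ) : ℤ) • z')) :=
  e3FF_unit_split_of (Lc := Lc) (fun κ u => lagrIncAt d ρ Lc (Lc ^ ℓ) (Lc ^ (ℓ + 1)) κ u) (fun κ u x z α ν => lagrIncAt_inl_inr ρ κ u x z α ν)
    (fun κ u x z μ b => lagrIncAt_inr ρ κ u x z μ b) cΛ ℓ k p hp κ' u' x' z' α β

/-- [folklore] **THE (Λ) TEMPLATE, TOP LEVEL, ROOTED** (`k = 0`, member `p = ℓ+1`, natural weight `cΛ·M^{2d+4}`). -/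
theorem e3LamTop_unit_split (ρ : Fin (d + 1) → ℤ) (cΛ : ℝ) (ℓ p : ℕ) (hp : p = ℓ + 1) (κ' : Fin (d + 1)) (u' x' z' : Fin (d + 1) → ℤ) (α β : Fin (d + 1)) :
    ((Lc : ℝ) ^ p) ^ (2 * (d + 1)) *
        e3OfS (Lc ^ p) (fun κ u => (cΛ * ((Lc : ℝ) ^ ℓ) ^ (2 * d + 4)) • lagrIncAt d ρ Lc (Lc ^ ℓ) (Lc ^ (ℓ + 1)) κ u) κ' u' x' z' (Sum.inl α) (Sum.inl β) =
      -(cΛ / (Lc : ℝ) ^ (d + 1)) * ((Lc : ℝ) ^ p) ^ ((d : ℤ) - 2) * ((Lc : ℝ) ^ ℓ) ^ (d + 3) *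
        ∑' y : Fin (d + 1) → ℤ, ∑ l' : Fin (d + 1),
          (∑' w : Fin (d + 1) → ℤ, ∑ l : Fin (d + 1), (((Lc : ℝ) ^ p) ^ (d + 2) * GamΦ (N := Lc ^ p) α x' l w) *
              ∑ κ'' : Fin (d + 1), (((Lc : ℝ) ^ p) ^ (d + 1))⁻¹ * ∑' u : Fin (d + 1) → ℤ,
                (((Lc : ℝ) ^ p) ^ (d + 2) * wH (N := Lc ^ p) κ'' κ' (u - ((Lc ^ p : ℕ) : ℤ) • u')) *
                  lagrIncAt d ρ Lc (Lc ^ ℓ) (Lc ^ (ℓ + 1)) κ'' u w y (Sum.inl l) (Sum.inl l')) *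
            (((Lc : ℝ) ^ p) ^ (d + 2) * wH (N := Lc ^ p) l' β (y - ((Lc ^ p : ℕ) : ℤ) • z')) := by
  simpa only [pow_zero, one_mul] using e3Lam_unit_split (Lc := Lc) (d := d) ρ cΛ ℓ 0 p (by simpa using hp) κ' u' x' z' α β

/-- [folklore] **THE (Λ) TEMPLATE, LEVEL `0`, ROOTED** (`S₀`'s rooted Lagrange stencil, natural weight `(Lc^{d+1})^k·cΛ`, member `p = k+1`; `M^{d+3} = 1`). -/
theorem e3Lam0_unit_split (ρ : Fin (d + 1) → ℤ) (cΛ : ℝ) (k p : ℕ) (hp : p = k + 1) (κ' : Fin (d + 1)) (u' x' z' : Fin (d + 1) → ℤ) (α β : Fin (d + 1)) :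
    ((Lc : ℝ) ^ p) ^ (2 * (d + 1)) *
        e3OfS (Lc ^ p) (fun κ u => (((Lc : ℝ) ^ (d + 1)) ^ k * cΛ) •
          SLam Lc (lamCoeffOf (KInv (N := Lc) (d := d)) Lc) (fun μ y => hessFFAt ρ Lc μ y) κ u) κ' u' x' z' (Sum.inl α) (Sum.inl β) =
      -(cΛ / (Lc : ℝ) ^ (d + 1)) * ((Lc : ℝ) ^ p) ^ ((d : ℤ) - 2) *
        ∑' y : Fin (d + 1) → ℤ, ∑ l' : Fin (d + 1),
          (∑' w : Fin (d + 1) → ℤ, ∑ l : Fin (d + 1), (((Lc : ℝ) ^ p) ^ (d + 2) * GamΦ (N := Lc ^ p) α x' l w) *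
              ∑ κ'' : Fin (d + 1), (((Lc : ℝ) ^ p) ^ (d + 1))⁻¹ * ∑' u : Fin (d + 1) → ℤ,
                (((Lc : ℝ) ^ p) ^ (d + 2) * wH (N := Lc ^ p) κ'' κ' (u - ((Lc ^ p : ℕ) : ℤ) • u')) *
                  SLam Lc (lamCoeffOf (KInv (N := Lc) (d := d)) Lc) (fun μ y => hessFFAt ρ Lc μ y) κ'' u w y (Sum.inl l) (Sum.inl l')) *
            (((Lc : ℝ) ^ p) ^ (d + 2) * wH (N := Lc ^ p) l' β (y - ((Lc ^ p : ℕ) : ℤ) • z')) := by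
  simpa only [pow_zero, one_pow, mul_one] using
    e3FF_unit_split_of (Lc := Lc) (fun κ u => SLam Lc (lamCoeffOf (KInv (N := Lc) (d := d)) Lc) (fun μ y => hessFFAt ρ Lc μ y) κ u)
      (fun κ u x z α ν => SLam0At_inl_inr ρ κ u x z α ν) (fun κ u x z μ b => SLam0At_inr ρ κ u x z μ b) cΛ 0 k p (by simpa using hp)
      κ' u' x' z' α β

/-! ### Bridges at the corner root `ρ = 0` (sanity: the rooted templates ARE the base ones) -/

/-- [folklore] At `ρ = 0` the rooted increment of the templates is the base increment (`lagrIncAt_zero`): the left-hand sides agree. -/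
theorem e3Lam_template_lhs_zero_root (cΛ : ℝ) (ℓ k p : ℕ) (κ' : Fin (d + 1)) (u' x' z' : Fin (d + 1) → ℤ) (α β : Fin (d + 1)) :
    e3OfS (Lc ^ p) (fun κ u => (((Lc : ℝ) ^ (d + 1)) ^ k * (cΛ * ((Lc : ℝ) ^ ℓ) ^ (2 * d + 4))) • lagrIncAt d 0 Lc (Lc ^ ℓ) (Lc ^ (ℓ + 1)) κ u)
        κ' u' x' z' (Sum.inl α) (Sum.inl β)
      = e3OfS (Lc ^ p) (fun κ u => (((Lc : ℝ) ^ (d + 1)) ^ k * (cΛ * ((Lc : ℝ) ^ ℓ) ^ (2 * d + 4))) • lagrInc d Lc (Lc ^ ℓ) (Lc ^ (ℓ + 1)) κ u)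
        κ' u' x' z' (Sum.inl α) (Sum.inl β) := by
  rw [lagrIncAt_zero]

/-- [folklore] At `ρ = 0` the rooted `S₀` stencil of the level-`0` template is the base one (`hessFFAt_zero`). -/
theorem e3Lam0_template_lhs_zero_root (cΛ : ℝ) (k p : ℕ) (κ' : Fin (d + 1)) (u' x' z' : Fin (d + 1) → ℤ) (α β : Fin (d + 1)) :
    e3OfS (Lc ^ p) (fun κ u => (((Lc : ℝ) ^ (d + 1)) ^ k * cΛ) •
          SLam Lc (lamCoeffOf (KInv (N := Lc) (d := d)) Lc) (fun μ y => hessFFAt 0 Lc μ y) κ u) κ' u' x' z' (Sum.inl α) (Sum.inl β)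
      = e3OfS (Lc ^ p) (fun κ u => (((Lc : ℝ) ^ (d + 1)) ^ k * cΛ) •
          SLam Lc (lamCoeffOf (KInv (N := Lc) (d := d)) Lc) (fun μ y => hessFF Lc μ y) κ u) κ' u' x' z' (Sum.inl α) (Sum.inl β) := by
  simp only [hessFFAt_zero]

end Levels

end Summit.QuantumFields.BalabanUV.Beta.GAN24.E3UnitSplitLevelsAt

end
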